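import Summits.ABC.IUTFork.LDHGenuinePerImageSharpWildRat
import Summits.ABC.IUTFork.Cor312GenuineKWildDifferentUnit
import HarnessLib

/-!
# The fork at [IUTchIII] Corollary 3.12, L-DH level, READING (P): the rational-point sufficiency with EVERY local ramification lever the tree
# proves — W1 and W2 poles over `3`, `5`, the sharp dyadic different, the Tate root (abc-iut cell, crux ThetaPartII = stmt-ABC-19678; «C:PERIMAGE-DSW-SUFF» part 2b)
Record-only PROOF file (D-0012; abc-iut-C-cert-1 gen 7). TAKES NO SIDE on [IUTchIII] Cor. 3.12. Same skeleton as part 2 (`LDHGenuinePerImageSharpWildRat`,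
floors form of part 1), two floors added: **`Cor22.cor312PerImageOf_ratPoint_sharp_wild_unit`** (statement in its docstring). abc-iut-W-num-2's desk
ranking of the levers (two-engine, about OUR typed objects, not kernel): W1 +220, I1 +73, W2 +41, I⁺ +20 N3 (triple, l) rows over DS = 976 of 2,158; which rows
flip is a table question. Nothing here asserts the existence of Θ-data, Cor. 3.12 in general or in print's reading, or abc; proved-as-typed ≠ in print.
[cite: Mochizuki2012, IUTchI Def. 3.1 (a)(b)(c) p. 61–62; IUTchIII Cor. 3.12 p. 173–174; IUTchIV Thm. 1.10 p. 22, Step (ii) p. 24, Step (v) p. 27–29]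
[cite: SilvermanATAEC1994, V.5 Thm. 5.3] [cite: SerreLocalFields1979, Ch. III §6 Prop. 13] [cite: NeukirchANT1999, Ch. III (2.6)]
[claim: Mochizuki2012, status: disputed] for every IUT quotation. PROOF-ONLY: no definitions, no new `Prop`. -/

noncomputable section

open NumberField IsDedekindDomain Ideal Module

namespace Literature.IUT.LogVolume.Cor22

open Literature.NumberTheory.DiophantineGeometry.GenEll Summit.ABC.IUTFork Literature.IUT.HodgeTheaters
open Literature.NumberTheory.NumberFields
open Literature.NumberTheory.DiophantineGeometry.UniformABCConjecture Rat.HeightOneSpectrum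
open Summit.ABC.IUTFork.Thm311.Real Summit.ABC.IUTFork.Conditional Summit.ABC.IUTFork.Cor312Prov
open Literature.IUT.LogThetaLattice

/-- The floor arithmetic: `m ∣ e`, `e > 0`, `A·e − 1 ≤ D` ⟹ `(A − 1/m)·e ≤ D`. [folklore] -/
private theorem floor_mul_le' {A : ℝ} {m e D : ℕ} (hm : 0 < m) (hme : m ∣ e) (he : 0 < e)
    (hD : A * e - 1 ≤ (D : ℝ)) : (A - (m : ℝ)⁻¹) * (e : ℝ) ≤ (D : ℝ) := by
  have hmle : (m : ℝ) ≤ e := by exact_mod_cast Nat.le_of_dvd he hme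
  have hm0 : (0 : ℝ) < m := by exact_mod_cast hm
  have h1 : 1 ≤ (m : ℝ)⁻¹ * e := by
    rw [le_inv_mul_iff₀ hm0]; simpa using hmle
  nlinarith

variable {q : ℚ} {l : ℕ} {N D : ℕ} {I : Finset ℕ} {e : ℕ → ℕ}

/-- Rearranging the floor sum into the row-normal form of the statement. [folklore] -/
private theorem sum_floor_eq' (h7 : 7 ≤ l) (B : ℕ → ℝ)
    (hBA : ∀ p ∈ I.filter (fun p => p ≠ 2 ∧ p ≠ l),
      B p = (if (p = 3 ∨ p = 5) ∧ 2 ∣ e p ∧ ¬ p ∣ e p / 2 then (2 : ℝ)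
                else if (p = 3 ∨ p = 5) ∧ 2 ∣ e p ∧ p ∣ e p / 2 ∧
                  padicValRat p (((jInv q)⁻¹ / (p : ℚ) ^ (e p)) ^ (p - 1) - 1) = 1 then 1 + (p : ℝ)⁻¹ else 1)
        - ((l * Nat.lcm (30 / Nat.gcd 30 (e p)) (if p = 3 then 2 else if p = 5 then 4 else 1) : ℕ) : ℝ)⁻¹)
    (hB2 : B 2 = (if 2 ∈ I then (3 : ℝ) / 2 - ((Nat.lcm 2 (30 / Nat.gcd 30 (e 2)) : ℕ) : ℝ)⁻¹ else 1)) (hBl : B l = 1 - ((l - 1 : ℕ) : ℝ)⁻¹) (hB3 : 3 ∉ I → B 3 = 1 - 2⁻¹)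
    (hB5 : 5 ∉ I → B 5 = 1 - 4⁻¹) :
    ∑ p ∈ I.filter (fun p => p ≠ 2 ∧ p ≠ l) ∪ ({2, l} ∪ ({3, 5} \ I)), B p * Real.log p =
      (∑ p ∈ I.filter (fun p => p ≠ 2 ∧ p ≠ l),
          ((if (p = 3 ∨ p = 5) ∧ 2 ∣ e p ∧ ¬ p ∣ e p / 2 then (2 : ℝ)
                else if (p = 3 ∨ p = 5) ∧ 2 ∣ e p ∧ p ∣ e p / 2 ∧
                  padicValRat p (((jInv q)⁻¹ / (p : ℚ) ^ (e p)) ^ (p - 1) - 1) = 1 then 1 + (p : ℝ)⁻¹ else 1)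
            - ((l * Nat.lcm (30 / Nat.gcd 30 (e p)) (if p = 3 then 2 else if p = 5 then 4 else 1) : ℕ) : ℝ)⁻¹)
            * Real.log p)
        + (if 2 ∈ I then (3 : ℝ) / 2 - ((Nat.lcm 2 (30 / Nat.gcd 30 (e 2)) : ℕ) : ℝ)⁻¹ else 1) * Real.log 2
        + (if 3 ∈ I then 0 else 2⁻¹ * Real.log 3)
        + (if 5 ∈ I then 0 else (3 / 4 : ℝ) * Real.log 5)
        + (1 - ((l - 1 : ℕ) : ℝ)⁻¹) * Real.log l := by
  -- as part 2's `sum_floor_eq` (adapted from abc-iut-c312-d1's private `sum_weights_eq`)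
  have hl2 : l ≠ 2 := by omega
  have hl3 : l ≠ 3 := by omega
  have hl5 : l ≠ 5 := by omega
  have hdisjA : Disjoint (I.filter (fun p => p ≠ 2 ∧ p ≠ l)) ({2, l} ∪ ({3, 5} \ I)) := by
    refine Finset.disjoint_left.mpr fun p hpA hpB => ?_
    obtain ⟨hpI, hP⟩ := Finset.mem_filter.mp hpA
    rcases Finset.mem_union.mp hpB with h | h
    · simp only [Finset.mem_insert, Finset.mem_singleton] at h
      omega
    · exact (Finset.mem_sdiff.mp h).2 hpI
  have hdisjB : Disjoint ({2, l} : Finset ℕ) ({3, 5} \ I) := by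
    refine Finset.disjoint_left.mpr fun p hp hp' => ?_
    have h35 := (Finset.mem_sdiff.mp hp').1
    simp only [Finset.mem_insert, Finset.mem_singleton] at hp h35
    omega
  rw [Finset.sum_union hdisjA, Finset.sum_union hdisjB]
  have hA : ∑ p ∈ I.filter (fun p => p ≠ 2 ∧ p ≠ l), B p * Real.log p =
      ∑ p ∈ I.filter (fun p => p ≠ 2 ∧ p ≠ l),
        ((if (p = 3 ∨ p = 5) ∧ 2 ∣ e p ∧ ¬ p ∣ e p / 2 then (2 : ℝ)
                else if (p = 3 ∨ p = 5) ∧ 2 ∣ e p ∧ p ∣ e p / 2 ∧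
                  padicValRat p (((jInv q)⁻¹ / (p : ℚ) ^ (e p)) ^ (p - 1) - 1) = 1 then 1 + (p : ℝ)⁻¹ else 1)
          - ((l * Nat.lcm (30 / Nat.gcd 30 (e p)) (if p = 3 then 2 else if p = 5 then 4 else 1) : ℕ) : ℝ)⁻¹)
          * Real.log p :=
    Finset.sum_congr rfl fun p hp => by rw [hBA p hp]
  have hB : ∑ p ∈ ({2, l} : Finset ℕ), B p * Real.log p =
      (if 2 ∈ I then (3 : ℝ) / 2 - ((Nat.lcm 2 (30 / Nat.gcd 30 (e 2)) : ℕ) : ℝ)⁻¹ else 1) * Real.log 2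
        + (1 - ((l - 1 : ℕ) : ℝ)⁻¹) * Real.log l := by
    rw [Finset.sum_pair hl2.symm, hB2, hBl]
    push_cast
    ring
  have hC : ∑ p ∈ ({3, 5} : Finset ℕ) \ I, B p * Real.log p =
      (if 3 ∈ I then 0 else 2⁻¹ * Real.log 3) + (if 5 ∈ I then 0 else (3 / 4 : ℝ) * Real.log 5) := by
    rw [Finset.sdiff_eq_filter, Finset.sum_filter, Finset.sum_pair (by norm_num : (3 : ℕ) ≠ 5)]
    congr 1
    · by_cases h3 : 3 ∈ I
      · rw [if_neg (not_not.mpr h3), if_pos h3]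
      · rw [if_pos h3, if_neg h3, hB3 h3]; norm_num
    · by_cases h5 : 5 ∈ I
      · rw [if_neg (not_not.mpr h5), if_pos h5]
      · rw [if_pos h5, if_neg h5, hB5 h5]; norm_num
  rw [hA, hB, hC]
  ring

/-- **RATIONAL POINTS, SHARPENED UNCONDITIONAL FORM WITH EVERY LOCAL LEVER OF THE TREE** («DS+W+W2+I⁺»): part 2's
`cor312PerImageOf_ratPoint_sharp_wild` with (i) weight `χ_p = 1 + 1/p` at a W2 pole `p ∈ {3,5}` (`e_p = 2t`, `p ∣ t`, non-split unit criterion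
`v_p(((j(q)⁻¹·p^{−e_p})^{p−1} − 1) = 1`; abc-iut-W-neg-1 p483835: `p ∣ e(u∣p)`, `ord_u 𝔇 ≥ e + e/p − 1`) and (ii) dyadic weight `3/2 − 1/lcm(2, 30/gcd(30,e_2))` at a
pole at `2` (abc-iut-W-num-2 p484518 sharp form `ord_u 𝔇 ≥ e + e/2 − 1`; `lcm(2, 30/gcd(30,e_2)) ∣ e(u∣2)` by `√−1` and the Tate root), else `1`. Conclusion:
`T.Cor312PerImageOf` at EVERY genuine Θ-volume datum `T` of `(q, l)` ([IUTchIII] Cor. 3.12 in the cell's READING (P), AS TYPED). [cite: Mochizuki2012,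
IUTchI Def. 3.1 (a)(b)(c) p. 61–62; IUTchIII Cor. 3.12 p. 173–174; IUTchIV Thm. 1.10 p. 22, Step (ii) p. 24, Step (v) p. 27–29] [cite: SilvermanATAEC1994,
V.5 Thm. 5.3] [cite: SerreLocalFields1979, Ch. III §6 Prop. 13] [cite: NeukirchANT1999, Ch. III (2.6)] [claim: Mochizuki2012, status: disputed] -/
theorem cor312PerImageOf_ratPoint_sharp_wild_unit (hq0 : q ≠ 0) (hq1 : q ≠ 1) (hl : l.Prime) (h7 : 7 ≤ l)
    (hI : ∀ p ∈ I, p.Prime) (he : ∀ p ∈ I, e p ≠ 0) (hD : D = ∏ p ∈ I, p ^ e p)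
    (hj : jInv q = (N : ℚ) / (D : ℚ)) (hN : N ≠ 0) (hcop : ∀ p ∈ I, ¬ p ∣ N)
    (h : (((l : ℝ) + 1) / 24 - 1 / (2 * l)) * logQAvoid (ratPoint q) {2, l} ≤
      (((l : ℝ) + 5) / 4 - 1) *
          ((∑ p ∈ I.filter (fun p => p ≠ 2 ∧ p ≠ l),
              ((if (p = 3 ∨ p = 5) ∧ 2 ∣ e p ∧ ¬ p ∣ e p / 2 then (2 : ℝ)
                else if (p = 3 ∨ p = 5) ∧ 2 ∣ e p ∧ p ∣ e p / 2 ∧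
                  padicValRat p (((jInv q)⁻¹ / (p : ℚ) ^ (e p)) ^ (p - 1) - 1) = 1 then 1 + (p : ℝ)⁻¹ else 1)
                - ((l * Nat.lcm (30 / Nat.gcd 30 (e p)) (if p = 3 then 2 else if p = 5 then 4 else 1) : ℕ) : ℝ)⁻¹)
                * Real.log p)
            + (if 2 ∈ I then (3 : ℝ) / 2 - ((Nat.lcm 2 (30 / Nat.gcd 30 (e 2)) : ℕ) : ℝ)⁻¹ else 1) * Real.log 2
            + (if 3 ∈ I then 0 else 2⁻¹ * Real.log 3)
            + (if 5 ∈ I then 0 else (3 / 4 : ℝ) * Real.log 5)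
            + (1 - ((l - 1 : ℕ) : ℝ)⁻¹) * Real.log l)
        + ((l : ℝ) + 5) / 4 * Real.log Real.pi)
    (T : ThetaVolumeDatumAt (ratPoint q) l) : T.Cor312PerImageOf := by
  classical
  letI := T.instFieldF; letI := T.instNumberFieldF; letI := T.instAlgebraF; letI := T.instFieldK
  letI := T.instNumberFieldK; letI := T.instAlgebraK; letI := T.instFieldFbar; letI := T.instAlgebraFbar
  letI := T.instAlgebraKFbar; letI := T.instIsElliptic
  letI : Algebra (ratPoint q).F T.K := ((algebraMap T.F T.K).comp (algebraMap (ratPoint q).F T.F)).toAlgebra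
  have hUP := ratPoint_mem_UPle_one hq0 hq1
  have hd1 : dmod (ratPoint q) = 1 := dmod_eq_one_of_degree_le_one (le_of_eq (degree_ratPoint _))
  have hl2 : l ≠ 2 := by omega
  have hl3 : l ≠ 3 := by omega
  have hl5 : l ≠ 5 := by omega
  obtain ⟨Ps, hPs⟩ : ∃ Ps : Finset ℕ, Ps = I.filter (fun p => p ≠ 2 ∧ p ≠ l) ∪ ({2, l} ∪ ({3, 5} \ I)) := ⟨_, rfl⟩
  have hPs_prime : ∀ p ∈ Ps, p.Prime := by
    intro p hp
    rw [hPs] at hp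
    rcases Finset.mem_union.mp hp with h | h
    · exact hI p (Finset.mem_filter.mp h).1
    · rcases Finset.mem_union.mp h with h | h
      · rcases Finset.mem_insert.mp h with rfl | h
        · exact Nat.prime_two
        · rw [Finset.mem_singleton] at h; subst h; exact hl
      · have h35 := (Finset.mem_sdiff.mp h).1
        rcases Finset.mem_insert.mp h35 with rfl | h35
        · norm_num
        · rw [Finset.mem_singleton] at h35; subst h35; norm_num
  -- the ramification floors at the poles `p ≠ 2, l` (abc-iut-c312-d1's weights) and the different floors
  obtain ⟨mA, hmA⟩ : ∃ mA : ℕ → ℕ, mA = fun p =>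
      l * Nat.lcm (30 / Nat.gcd 30 (e p)) (if p = 3 then 2 else if p = 5 then 4 else 1) := ⟨_, rfl⟩
  obtain ⟨B, hB⟩ : ∃ B : ℕ → ℝ, B = fun p =>
      if p ∈ I ∧ (p ≠ 2 ∧ p ≠ l) then
        (if (p = 3 ∨ p = 5) ∧ 2 ∣ e p ∧ ¬ p ∣ e p / 2 then (2 : ℝ)
                else if (p = 3 ∨ p = 5) ∧ 2 ∣ e p ∧ p ∣ e p / 2 ∧
                  padicValRat p (((jInv q)⁻¹ / (p : ℚ) ^ (e p)) ^ (p - 1) - 1) = 1 then 1 + (p : ℝ)⁻¹ else 1) - (mA p : ℝ)⁻¹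
      else if p = 2 then (if 2 ∈ I then (3 : ℝ) / 2 - ((Nat.lcm 2 (30 / Nat.gcd 30 (e 2)) : ℕ) : ℝ)⁻¹ else 1)
      else if p = l then 1 - ((l - 1 : ℕ) : ℝ)⁻¹
      else if p = 5 then 1 - 4⁻¹ else 1 - 2⁻¹ := ⟨_, rfl⟩
  have hcpos : ∀ p, 0 < (if p = 3 then 2 else if p = 5 then 4 else 1 : ℕ) := by
    intro p; split_ifs <;> norm_num
  have hrpos : ∀ p, 0 < 30 / Nat.gcd 30 (e p) := fun p =>
    Nat.div_pos (Nat.gcd_le_left _ (by norm_num)) (Nat.gcd_pos_of_pos_left _ (by norm_num))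
  have hmApos : ∀ p, 0 < mA p := fun p => by
    rw [hmA]; exact Nat.mul_pos hl.pos (Nat.lcm_pos (hrpos p) (hcpos p))
  have hBA : ∀ p ∈ I.filter (fun p => p ≠ 2 ∧ p ≠ l),
      B p = (if (p = 3 ∨ p = 5) ∧ 2 ∣ e p ∧ ¬ p ∣ e p / 2 then (2 : ℝ)
                else if (p = 3 ∨ p = 5) ∧ 2 ∣ e p ∧ p ∣ e p / 2 ∧
                  padicValRat p (((jInv q)⁻¹ / (p : ℚ) ^ (e p)) ^ (p - 1) - 1) = 1 then 1 + (p : ℝ)⁻¹ else 1)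
        - ((l * Nat.lcm (30 / Nat.gcd 30 (e p)) (if p = 3 then 2 else if p = 5 then 4 else 1) : ℕ) : ℝ)⁻¹ := by
    intro p hp
    obtain ⟨hpI, hp2l⟩ := Finset.mem_filter.mp hp
    simp only [hB, hmA, if_pos (And.intro hpI hp2l)]
  have hB2 : B 2 = (if 2 ∈ I then (3 : ℝ) / 2 - ((Nat.lcm 2 (30 / Nat.gcd 30 (e 2)) : ℕ) : ℝ)⁻¹ else 1) := by
    simp [hB]
  have hBl : B l = 1 - ((l - 1 : ℕ) : ℝ)⁻¹ := by simp [hB, hl2]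
  have hB3 : 3 ∉ I → B 3 = 1 - 2⁻¹ := fun h3 => by simp [hB, h3, Ne.symm hl3]
  have hB5 : 5 ∉ I → B 5 = 1 - 4⁻¹ := fun h5 => by simp [hB, h5, Ne.symm hl5]
  have hfloor : ∀ p ∈ Ps, ∀ w ∈ placesOver T.K p,
      B p * (w.asIdeal.ramificationIdx ℤ : ℝ) ≤ (multiplicity w.asIdeal (differentIdeal ℤ (𝓞 T.K)) : ℝ) := by
    intro p hp w hw
    have hpp : p.Prime := hPs_prime p hp
    haveI : Fact p.Prime := ⟨hpp⟩
    have hpw : ((p : ℕ) : 𝓞 T.K) ∈ w.asIdeal := by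
      have h := (mem_placesOver_iff w).mp hw
      have hmem : ((p : ℕ) : ℤ) ∈ w.asIdeal.under ℤ := by
        rw [← h.over]; exact Ideal.mem_span_singleton_self _
      have := Ideal.mem_comap.mp hmem
      simpa using this
    obtain ⟨hpv, hwv, hconv⟩ := T.under_ratPoint_spec w hpw
    set v := w.under (𝓞 (ratPoint q).F) with hvdef
    have hgen : natGenerator (show HeightOneSpectrum (𝓞 ℚ) from v) = p :=
      (Nat.prime_dvd_prime_iff_eq (prime_natGenerator (show HeightOneSpectrum (𝓞 ℚ) from v)) hpp).mp
        ((natCast_mem_asIdeal_iff (show HeightOneSpectrum (𝓞 ℚ) from v) p).mp hpv)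
    have he0 : 0 < w.asIdeal.ramificationIdx ℤ := Ideal.ramificationIdx_pos _ _
    have htame : w.asIdeal.ramificationIdx ℤ - 1 ≤ multiplicity w.asIdeal (differentIdeal ℤ (𝓞 T.K)) :=
      ramificationIdx_int_sub_one_le_multiplicity w
    have htameR : (1 : ℝ) * (w.asIdeal.ramificationIdx ℤ : ℝ) - 1 ≤
        (multiplicity w.asIdeal (differentIdeal ℤ (𝓞 T.K)) : ℝ) := by
      have h' : w.asIdeal.ramificationIdx ℤ ≤ multiplicity w.asIdeal (differentIdeal ℤ (𝓞 T.K)) + 1 := by omega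
      have h'' : (w.asIdeal.ramificationIdx ℤ : ℝ) ≤ (multiplicity w.asIdeal (differentIdeal ℤ (𝓞 T.K)) : ℝ) + 1 := by
        exact_mod_cast h'
      linarith
    rw [hPs] at hp
    rcases Finset.mem_union.mp hp with hpA | hpBC
    · -- a pole `p ≠ 2, l`: `m_p ∣ e(w ∣ p)` (abc-iut-c312-d1's part 2, BY NAME)
      obtain ⟨hpI, hp2, hpl⟩ := Finset.mem_filter.mp hpA
      have hpS : ∀ s ∈ ({2, l} : Finset ℕ), ¬ p ∣ s := by
        intro s hs hps
        simp only [Finset.mem_insert, Finset.mem_singleton] at hs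
        rcases hs with rfl | rfl
        · exact hp2 ((Nat.prime_dvd_prime_iff_eq hpp Nat.prime_two).mp hps)
        · exact hpl ((Nat.prime_dvd_prime_iff_eq hpp hl).mp hps)
      have hbad : (show HeightOneSpectrum (𝓞 ℚ) from v) ∈ badPlacesAvoid (ratPoint q) {2, l} :=
        mem_badPlacesAvoid_ratPoint_of_natGenerator_eq hI he hD hj hN {2, l} hpI (hcop p hpI) hpS _ hgen
      have hldvd := ThetaVolumeDatumAt.l_dvd_ramificationIdx'_of_mem_badPlacesAvoid T v hbad w.asIdeal hwv
      have hkF : ∀ x : HeightOneSpectrum (𝓞 T.F), ((p : ℕ) : 𝓞 T.F) ∈ x.asIdeal →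
          Nat.lcm (30 / Nat.gcd 30 (e p)) (if p = 3 then 2 else if p = 5 then 4 else 1) ∣
            x.asIdeal.ramificationIdx ℤ := by
        intro x hx
        refine Nat.lcm_dvd (T.div_gcd_thirty_dvd_ramificationIdx_F hI he hD hj hN hpI (hcop p hpI) x hx) ?_
        by_cases h3 : p = 3
        · rw [if_pos h3]; subst h3
          exact T.sub_one_dvd_ramificationIdx_int (by norm_num) (by norm_num) x hx
        · rw [if_neg h3]
          by_cases h5 : p = 5
          · rw [if_pos h5]; subst h5
            exact T.sub_one_dvd_ramificationIdx_int (by norm_num) (by norm_num) x hx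
          · rw [if_neg h5]; exact one_dvd _
      have hkdvd := T.dvd_ramificationIdx'_ratPoint_of_forall hkF v hpv w.asIdeal hwv
      have hcop60 : Nat.Coprime (Nat.lcm (30 / Nat.gcd 30 (e p)) (if p = 3 then 2 else if p = 5 then 4 else 1)) l := by
        have h60 : Nat.lcm (30 / Nat.gcd 30 (e p)) (if p = 3 then 2 else if p = 5 then 4 else 1) ∣ 60 := by
          refine Nat.lcm_dvd ((Nat.div_dvd_of_dvd (Nat.gcd_dvd_left 30 (e p))).trans (by norm_num)) ?_
          split_ifs <;> norm_num
        have hc : Nat.Coprime 60 l := by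
          have h2 : Nat.Coprime 2 l := (Nat.coprime_primes Nat.prime_two hl).mpr hl2.symm
          have h3 : Nat.Coprime 3 l := (Nat.coprime_primes (by norm_num) hl).mpr hl3.symm
          have h5 : Nat.Coprime 5 l := (Nat.coprime_primes (by norm_num) hl).mpr hl5.symm
          have : (60 : ℕ) = 2 * 2 * 3 * 5 := by norm_num
          rw [this]
          exact ((h2.mul_left h2).mul_left h3).mul_left h5
        exact Nat.Coprime.coprime_dvd_left h60 hc
      have hmdvd : l * Nat.lcm (30 / Nat.gcd 30 (e p)) (if p = 3 then 2 else if p = 5 then 4 else 1) ∣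
          w.asIdeal.ramificationIdx ℤ := by
        rw [← hconv, mul_comm]
        exact hcop60.mul_dvd_of_dvd_of_dvd hkdvd hldvd
      have hmpos : 0 < l * Nat.lcm (30 / Nat.gcd 30 (e p)) (if p = 3 then 2 else if p = 5 then 4 else 1) := by
        have h0 := hmApos p
        simp only [hmA] at h0
        exact h0
      rw [hBA p hpA]
      by_cases hW1 : (p = 3 ∨ p = 5) ∧ 2 ∣ e p ∧ ¬ p ∣ e p / 2
      · -- a W1 pole over `3` or `5`: the WILD bound `2e − 1 ≤ ord_w 𝔇` (abc-iut-W-neg-1, BY NAME)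
        rw [if_pos hW1]
        obtain ⟨hp35, h2e, hpt⟩ := hW1
        have hp30 : p ∣ 30 := by rcases hp35 with rfl | rfl <;> norm_num
        obtain ⟨t, ht⟩ := h2e
        have ht0 : 0 < t := by
          rcases Nat.eq_zero_or_pos t with h0 | h0
          · exfalso; apply he p hpI; rw [ht, h0]
          · exact h0
        have hpt' : ¬ p ∣ t := by rwa [ht, Nat.mul_div_cancel_left t (by norm_num : 0 < 2)] at hpt
        have hpole : ∀ v' : HeightOneSpectrum (𝓞 ℚ), natGenerator v' = (⟨p, hpp⟩ : Nat.Primes) →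
            ord ℚ v' (jInv q) = -(2 * (t : ℤ)) := by
          intro v' hv'
          have h1 := ord_jInv_ratPoint_of_mem hI hD hj hN v' (by rw [hv']; exact hpI) (by rw [hv']; exact hcop p hpI)
          rw [h1, hv']
          change -((e p : ℕ) : ℤ) = _
          rw [ht]; push_cast; ring
        have hwild := GenuineK.sub_one_le_multiplicity_differentIdeal_placeOf_wild_ratPoint T ⟨p, hpp⟩ hp30 hp2 ht0 hpt'
          hpole ((fibreEquivPlacesOver (pilotDataOfK T.D T.K) ⟨p, hpp⟩).symm ⟨w, hw⟩)
        have hplace : placeOf (pilotDataOfK T.D T.K) p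
            ((fibreEquivPlacesOver (pilotDataOfK T.D T.K) ⟨p, hpp⟩).symm ⟨w, hw⟩) = w := by
          show ((fibreEquivPlacesOver (pilotDataOfK T.D T.K) ⟨p, hpp⟩)
            ((fibreEquivPlacesOver (pilotDataOfK T.D T.K) ⟨p, hpp⟩).symm ⟨w, hw⟩)).1 = w
          rw [Equiv.apply_symm_apply]
        rw [hplace] at hwild
        refine floor_mul_le' hmpos hmdvd he0 ?_
        have h' : 2 * w.asIdeal.ramificationIdx ℤ ≤ multiplicity w.asIdeal (differentIdeal ℤ (𝓞 T.K)) + 1 := by omega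
        have h'' : (2 : ℝ) * (w.asIdeal.ramificationIdx ℤ : ℝ) ≤
            (multiplicity w.asIdeal (differentIdeal ℤ (𝓞 T.K)) : ℝ) + 1 := by exact_mod_cast h'
        linarith
      · rw [if_neg hW1]
        by_cases hW2 : (p = 3 ∨ p = 5) ∧ 2 ∣ e p ∧ p ∣ e p / 2 ∧
            padicValRat p (((jInv q)⁻¹ / (p : ℚ) ^ (e p)) ^ (p - 1) - 1) = 1
        · -- a W2 pole over `3` or `5` (non-split unit): `p ∣ e` and `e + e/p − 1 ≤ ord_w 𝔇` (abc-iut-W-neg-1, BY NAME)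
          rw [if_pos hW2]
          obtain ⟨hp35, h2e, hpt, hunit⟩ := hW2
          have hp30 : p ∣ 30 := by rcases hp35 with rfl | rfl <;> norm_num
          obtain ⟨t, ht⟩ := h2e
          have ht0 : 0 < t := by
            rcases Nat.eq_zero_or_pos t with h0 | h0
            · exfalso; apply he p hpI; rw [ht, h0]
            · exact h0
          have hpt' : p ∣ t := by rwa [ht, Nat.mul_div_cancel_left t (by norm_num : 0 < 2)] at hpt
          have hunit' : padicValRat (⟨p, hpp⟩ : Nat.Primes)
              ((((jInv q)⁻¹ / (((⟨p, hpp⟩ : Nat.Primes) : ℕ) : ℚ) ^ (2 * t)) ^ (((⟨p, hpp⟩ : Nat.Primes) : ℕ) - 1) - 1)) = 1 := by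
            rw [← ht]; exact hunit
          have hpole : ∀ v' : HeightOneSpectrum (𝓞 ℚ), natGenerator v' = (⟨p, hpp⟩ : Nat.Primes) →
              ord ℚ v' (jInv q) = -(2 * (t : ℤ)) := by
            intro v' hv'
            have h1 := ord_jInv_ratPoint_of_mem hI hD hj hN v' (by rw [hv']; exact hpI) (by rw [hv']; exact hcop p hpI)
            rw [h1, hv']
            change -((e p : ℕ) : ℤ) = _
            rw [ht]; push_cast; ring
          set x₀ := (fibreEquivPlacesOver (pilotDataOfK T.D T.K) ⟨p, hpp⟩).symm ⟨w, hw⟩ with hx₀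
          have hplace : placeOf (pilotDataOfK T.D T.K) p x₀ = w := by
            show ((fibreEquivPlacesOver (pilotDataOfK T.D T.K) ⟨p, hpp⟩)
              ((fibreEquivPlacesOver (pilotDataOfK T.D T.K) ⟨p, hpp⟩).symm ⟨w, hw⟩)).1 = w
            rw [Equiv.apply_symm_apply]
          have hwild := GenuineK.add_div_sub_one_le_multiplicity_differentIdeal_placeOf_wildUnit_ratPoint T ⟨p, hpp⟩ hp30 hp2
            ht0 hpt' hpole hunit' x₀
          have hpdvd : p ∣ w.asIdeal.ramificationIdx ℤ := by
            have h := GenuineK.prime_dvd_absRamificationIdx_kOf_wildUnit_ratPoint T ⟨p, hpp⟩ hp30 hp2 ht0 hpt' hpole hunit' x₀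
            rw [show absRamificationIdx p (kOf (pilotDataOfK T.D T.K) p x₀) =
                absRamificationIdx p (RescaledCompletion T.K p (placeOf (pilotDataOfK T.D T.K) p x₀)
                  (natCast_mem_placeOf (pilotDataOfK T.D T.K) p x₀)) from rfl,
              absRamificationIdx_rescaledCompletion, hplace] at h
            exact h
          rw [hplace] at hwild
          refine floor_mul_le' hmpos hmdvd he0 ?_
          obtain ⟨c, hc⟩ := hpdvd
          have hp0 : (0 : ℝ) < p := by exact_mod_cast hpp.pos
          have hdiv : w.asIdeal.ramificationIdx ℤ / p = c := by
            rw [hc, Nat.mul_div_cancel_left c hpp.pos]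
          rw [hdiv] at hwild
          have h' : w.asIdeal.ramificationIdx ℤ + c ≤ multiplicity w.asIdeal (differentIdeal ℤ (𝓞 T.K)) + 1 := by omega
          have h'' : (w.asIdeal.ramificationIdx ℤ : ℝ) + c ≤
              (multiplicity w.asIdeal (differentIdeal ℤ (𝓞 T.K)) : ℝ) + 1 := by exact_mod_cast h'
          have hcR : (c : ℝ) = (p : ℝ)⁻¹ * (w.asIdeal.ramificationIdx ℤ : ℝ) := by
            rw [hc]; push_cast; field_simp
          rw [hcR] at h''
          nlinarith
        · rw [if_neg hW2]
          exact floor_mul_le' hmpos hmdvd he0 htameR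
    · rcases Finset.mem_union.mp hpBC with hpB | hpC
      · rcases Finset.mem_insert.mp hpB with rfl | hpB
        · -- `p = 2`: WILD (`√−1 ∈ K`; abc-iut-W-num-2, BY NAME): `e ≤ ord_u 𝔇`, and `e + e/2 − 1 ≤ ord_u 𝔇` with `lcm(2, 30/gcd(30,e_2)) ∣ e` at a pole
          rw [hB2]
          by_cases h2I : 2 ∈ I
          · rw [if_pos h2I]
            have hsharp := T.ramificationIdx_add_le_multiplicity_differentIdeal_over_two w hpw
            have h2dvd : 2 ∣ w.asIdeal.ramificationIdx ℤ := by
              rw [← hconv]; exact T.two_dvd_ramificationIdx'_ratPoint v hpv w.asIdeal hwv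
            have hkF : ∀ x : HeightOneSpectrum (𝓞 T.F), ((2 : ℕ) : 𝓞 T.F) ∈ x.asIdeal →
                30 / Nat.gcd 30 (e 2) ∣ x.asIdeal.ramificationIdx ℤ := fun x hx =>
              T.div_gcd_thirty_dvd_ramificationIdx_F hI he hD hj hN h2I (hcop 2 h2I) x hx
            have hrdvd : 30 / Nat.gcd 30 (e 2) ∣ w.asIdeal.ramificationIdx ℤ := by
              rw [← hconv]; exact T.dvd_ramificationIdx'_ratPoint_of_forall hkF v hpv w.asIdeal hwv
            have hmdvd : Nat.lcm 2 (30 / Nat.gcd 30 (e 2)) ∣ w.asIdeal.ramificationIdx ℤ := Nat.lcm_dvd h2dvd hrdvd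
            have hmpos : 0 < Nat.lcm 2 (30 / Nat.gcd 30 (e 2)) := Nat.lcm_pos (by norm_num) (hrpos 2)
            refine floor_mul_le' hmpos hmdvd he0 ?_
            obtain ⟨c, hc⟩ := h2dvd
            have hdiv : w.asIdeal.ramificationIdx ℤ / 2 = c := by rw [hc, Nat.mul_div_cancel_left c (by norm_num : 0 < 2)]
            rw [hdiv] at hsharp
            have h' : w.asIdeal.ramificationIdx ℤ + c ≤ multiplicity w.asIdeal (differentIdeal ℤ (𝓞 T.K)) + 1 := by omega
            have h'' : (w.asIdeal.ramificationIdx ℤ : ℝ) + c ≤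
                (multiplicity w.asIdeal (differentIdeal ℤ (𝓞 T.K)) : ℝ) + 1 := by exact_mod_cast h'
            have hcR : (c : ℝ) = 2⁻¹ * (w.asIdeal.ramificationIdx ℤ : ℝ) := by rw [hc]; push_cast; ring
            rw [hcR] at h''
            linarith
          · rw [if_neg h2I, one_mul]
            exact_mod_cast T.ramificationIdx_le_multiplicity_differentIdeal_over_two w hpw
        · -- `p = l`: `(l − 1) ∣ e(w ∣ l)` (`μ_l ⊂ K`) and the tame bound
          rw [Finset.mem_singleton] at hpB
          subst hpB
          rw [hBl]
          have hdvd : (p - 1) ∣ w.asIdeal.ramificationIdx ℤ := by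
            rw [← hconv]; exact T.sub_one_dvd_ramificationIdx'_ratPoint_l v hpv w.asIdeal hwv
          exact floor_mul_le' (by omega) hdvd he0 htameR
      · -- `p ∈ {3, 5} ∖ I`: `(p − 1) ∣ e(w ∣ p)` (`μ₃₀ ⊂ F`) and the tame bound
        obtain ⟨h35, hnot⟩ := Finset.mem_sdiff.mp hpC
        rcases Finset.mem_insert.mp h35 with rfl | h35
        · rw [hB3 hnot]
          have hdvd : (3 - 1) ∣ w.asIdeal.ramificationIdx ℤ := by
            rw [← hconv]
            exact T.sub_one_dvd_ramificationIdx'_ratPoint_of_dvd_thirty (by norm_num) (by norm_num) v hpv w.asIdeal hwv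
          exact floor_mul_le' (by norm_num) hdvd he0 htameR
        · rw [Finset.mem_singleton] at h35
          subst h35
          rw [hB5 hnot]
          have hdvd : (5 - 1) ∣ w.asIdeal.ramificationIdx ℤ := by
            rw [← hconv]
            exact T.sub_one_dvd_ramificationIdx'_ratPoint_of_dvd_thirty (by norm_num) (by norm_num) v hpv w.asIdeal hwv
          exact floor_mul_le' (by norm_num) hdvd he0 htameR
  refine T.cor312PerImageOf_of_le_floor hUP.1.1
    (by rw [hd1]; have : (7 : ℝ) ≤ l := by exact_mod_cast h7
        push_cast; linarith) Ps hPs_prime B hfloor ?_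
  have harch : ThetaVolumeInput.archLogTheta l = ((l : ℝ) + 5) / 4 * Real.log Real.pi := rfl
  rw [harch, hd1, hPs, sum_floor_eq' h7 B hBA hB2 hBl hB3 hB5, Nat.cast_one]
  exact h

end Literature.IUT.LogVolume.Cor22

end
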